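import Summits.Ventures.HSemireg.SiegelComponentChart
import Summits.Ventures.HSemireg.ComponentTransferSubscheme
import Literature.AlgebraicGeometry.HodgeTheory.BlochSemiregularSpreadOfSubschemeGlobal
import HarnessLib

/-!
# Venture HSemireg — the 𝒜_g-form of the transfer chain for an ARBITRARY (possibly reducible) local
# complete intersection representative on a fibre of the universal family (Bloch 1972 (7.1)/(7.4)/(7.5)
# with «the topological cycle class [Z₀]»)

HONEST FRAMING. Assembly file of the computation cell `pub-hsemireg` (theory seat 3); THEOREMS ONLY, no new definition,
nothing asserted about any variety, no claim that HC / HC_CM / HC_AV holds. `SiegelComponentChart.lean` gives the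
𝒜_{g,δ,N}-form of the chain for an INTEGRAL Bloch-semiregular lci representative (`hc_on_siegelComponent_of_semiregular`,
class hypothesis «supported on `Z`», and its Remark (7.5) form). The cell's verdict-bearing representatives are REDUCIBLE
local complete intersections on a fibre of the universal family (STEP-0 class (A): Schoen's `Δ ∪ (C × C) ⊂ J(C)²`; Prong C's
`Δ ∪ T`), for which Bloch's printed class hypothesis is «the topological cycle class `[Z₀]`» — in the tree the refereed named
fact `BlochSemiregularSpreadOfSubscheme n p` (`x = subschemeClass …`, Fulton's `[Z] = Σᵢ ℓ(𝒪_{Z,Zᵢ})·cl(Zᵢ)`) and its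
proved global / Remark (7.5) consequences (`BlochSemiregularSpreadOfSubschemeGlobal.lean`). `ComponentTransferSubscheme.lean`
composes that door for an ARBITRARY family with the chart as the raw hypothesis `SweepsClasses`; this file composes it with
the chart ASSUMPTION `SiegelHodgeLocusChart g δ N` of `SiegelComponentChart.lean`, so that the statement reads on the
universal family `D.f : D.𝒳 ⟶ D.S` of a Siegel fine moduli datum `D : SiegelModuliDatum g δ N`, with the representative
`Z ↪ 𝒴_{t₀}` sitting on a fibre of the UNIVERSAL FAMILY (not on a fibre of the hidden chart):

* `hc_on_siegelComponent_of_semiregular_subscheme` — `SiegelHodgeLocusChart g δ N` ∧ `BlochSemiregularSpreadOfSubscheme g p`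
  ∧ ONE point `(t₀, α₀) ∈ C` with an lci `Z ↪ 𝒴_{t₀}` of codimension `p`, Bloch-semiregular, `[Z] ∈ Z_d(𝒴_{t₀})`,
  `α₀ = [Z]` ⟹ `α` algebraic for EVERY `(t, α) ∈ C`.
* `hc_on_siegelComponent_of_semiregular_subscheme_of_smul_add` — Remark (7.5) / the cell's `q·hⁿ + w` form:
  `a·α₀ + b·Λ|_{𝒴_{t₀}} = [Z]` with `a, b ∈ ℚ`, `a ≠ 0`, `Λ` a GLOBAL class of the universal family, fibrewise rational
  `(p,p)` AND fibrewise algebraic (the `p`-th power of the relative polarisation) ⟹ `α` algebraic for every `(t, α) ∈ C`.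
  THIS is the form a computed certificate for a reducible cycle plugs into (a non-zero `h`-primitive class — a Weil class —
  is never `[Z]` itself; red team RED-1 v2 V2-T2).

Proof (both): take the chart `(𝒳, T, f, Φ, W)` of `C` from the assumption; at the special point the assumption provides
`u₀ ∈ T(ℂ)` and a `Φ`-compatible `e₀ : 𝒳_{u₀} ≅ 𝒴_{t₀}` with `e₀^* α₀ = W|_{𝒳_{u₀}}`; read the class identity through
`e₀.symm : 𝒴_{t₀} ≅ 𝒳_{u₀}` (the named fact is stated for any `X₀ ≅ 𝒳_{s₀}`, so NO transport of `Z`, of its resolution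
family or of its semiregularity is needed); `BlochSemiregularSpreadOfSubscheme.forall_mem_algebraicClasses{_of_rat_smul_add}`
(GLOBAL along the irreducible smooth quasi-projective `T`, with the tree's PROOF `charlesSchnell_algebraicityLocus_iUnion_closed_holds`)
makes `W` algebraic on every chart fibre (after subtracting the fibrewise algebraic `Φ^*Λ` and dividing by `a`); sweep.

Inputs BY NAME: `hA : SiegelHodgeLocusChart g δ N` (ASSUMPTION A-chart: CDK95 Thm. 1.1 + Moonen98 2.4 + smoothness at neat
level + Deligne Hodge II 4.1.1; `SiegelComponentChart.lean`); `hBS : BlochSemiregularSpreadOfSubscheme g p` (refereed named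
fact: Bloch (7.4) with (7.1), BF Thm. 5.2). NOT inputs: HC_CM, CM-ness of `t₀`, CM density, André–Oort, finiteness of
Mumford–Tate types (`theory/TH3-MT-FINITENESS.md`). Sheaf representatives: `ComponentTransferSheaf.lean` (general-family
form only — the sheaf must sit on a chart fibre, since the BF fact carries no fibre identification).

References: [Bloch1972Semiregularity] Invent. Math. 17 (1972), (7.1) p. 64, (7.4), (7.5) p. 65; [BuchweitzFlenner2003]
Compositio Math. 137 (2003), Thm. 5.2; [Fulton1998] §1.5, §19.1; [CattaniDeligneKaplan1995JAMS] Thm. 1.1, Cor. 1.2–1.3;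
[DeligneHodgeII1971] Thm. 4.1.1; [Moonen1998LinearityI] 2.4; [CharlesSchnell2014Notes] Prop. 11.3.11.
-/

noncomputable section

open CategoryTheory AlgebraicGeometry Set
open Literature.AlgebraicGeometry.Motives Literature.AlgebraicGeometry.HodgeTheory
open Literature.AlgebraicGeometry.ModuliOfAbelianVarieties

namespace Summit.Ventures.HSemireg

local notation3 (prettyPrint := false) "Res[" f ", " s ", " k ", " A "]" =>
  complexBetti.map (Literature.AlgebraicGeometry.Motives.fiberι f s) k A

section Subscheme

variable {g : ℕ} {δ : Fin g → ℕ} {N : ℕ}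

/-- **The transfer chain on 𝒜_{g,δ,N}, arbitrary lci representative — plain form** (Bloch (7.4) with the class hypothesis
of (7.1): «the topological cycle class `[Z₀]`»). Granted `SiegelHodgeLocusChart g δ N` and the named fact
`BlochSemiregularSpreadOfSubscheme g p`: for every component `C` of the locus of Hodge classes (degree `2p`) of the universal
family of a Siegel datum `D` and ONE point `(t₀, α₀) ∈ C` carrying a closed lci subscheme `Z ↪ 𝒴_{t₀}` of codimension `p`
(reducible / non-reduced allowed), Bloch-semiregular, with Fulton cycle `[Z] ∈ Z_d(𝒴_{t₀})`, `d + p = g`, and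
`α₀ = [Z]` (the tree's `subschemeClass`, read through any resolution family `ρ`), the class `α` is algebraic for EVERY
`(t, α) ∈ C`. [cite: Bloch1972Semiregularity, Thm. (7.4) with Thm. (7.1), pp. 64–65] [cite: BuchweitzFlenner2003, Thm. 5.2]
[cite: CattaniDeligneKaplan1995JAMS, Thm. 1.1 and Cor. 1.2] -/
theorem hc_on_siegelComponent_of_semiregular_subscheme (hA : SiegelHodgeLocusChart g δ N) {p : ℕ}
    (hBS : BlochSemiregularSpreadOfSubscheme g p) (D : SiegelModuliDatum g δ N) (C : HodgeLocusComponent D.f g p)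
    {x₀ : FiberClass D.f (2 * p)} (hx₀ : x₀ ∈ C.carrier)
    (d : ℕ) (hdp : d + p = g) (ρ : ResolutionFamily (fiberOver D.f x₀.pt) d)
    {Z : Scheme.{0}} (i : Z ⟶ (fiberOver D.f x₀.pt).left) [IsLocallyNoetherian Z] (hi : IsClosedImmersion i)
    (hreg : IsRegularImmersionOfCodim i p) (hcodim : ∀ z ∈ Set.range i.base, (p : ℕ∞) ≤ Order.coheight z)
    (hsr : IsBlochSemiregular i g p) (hmem : subschemeCycle i hi ∈ cyclesOfDim (fiberOver D.f x₀.pt).left d)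
    (hcls : x₀.cls = subschemeClass (D.isSmoothProjectiveFamily.isSmoothProjective x₀.pt) hdp ρ i hi) :
    ∀ x ∈ C.carrier, x.cls ∈ algebraicClasses (fiberOver D.f x.pt) p := by
  obtain ⟨𝒳, T, f, Φ, W, hf, h𝒳, hT, hTs, hTi, hW, -, hsweep⟩ := hA.exists_sweepsClasses D p C
  haveI := hTi
  exact hc_on_component_of_semiregular_subscheme hBS C hf h𝒳 hT hTs hW hsweep hx₀ _ d hdp ρ i hi hreg hcodim
    hsr hmem hcls

/-- **The transfer chain on 𝒜_{g,δ,N}, arbitrary lci representative — Bloch's Remark (7.5) form (the cell's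
`q·hⁿ + w`).** Granted `SiegelHodgeLocusChart g δ N` and `BlochSemiregularSpreadOfSubscheme g p`: let
`Λ ∈ H²ᵖ(D.𝒳(ℂ); ℂ)` be a global class of the universal family, fibrewise rational of type `(p,p)` AND fibrewise algebraic
(the `p`-th power of the relative polarisation class); `C` a component of the locus of Hodge classes; `(t₀, α₀) ∈ C`; and
`Z ↪ 𝒴_{t₀}` a closed lci subscheme of codimension `p` (reducible / non-reduced allowed), Bloch-semiregular, with
`[Z] ∈ Z_d(𝒴_{t₀})`, `d + p = g`, such that `a·α₀ + b·Λ|_{𝒴_{t₀}} = [Z]` for rationals `a ≠ 0`, `b` («there exist integers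
`a, b`, `a ≠ 0`, such that `a z₀ + b l₀ᵖ` is the class of a subscheme `Z₀ ⊂ X₀` which is semi-regular and a local complete
intersection»). Then `α` is algebraic for EVERY `(t, α) ∈ C`. Proof: on the chart `(𝒳, T, f, Φ, W)` of `C`, with
`L := Φ^*Λ` (fibrewise rational `(p,p)` and algebraic, every chart fibre being a fibre of `D.f`) and the `Φ`-compatible
`e₀ : 𝒳_{u₀} ≅ 𝒴_{t₀}`, the identity reads `a·e₀^{-1 *}(W|_{u₀}) + b·e₀^{-1 *}(L|_{u₀}) = [Z]` on `X₀ := 𝒴_{t₀} ≅ 𝒳_{u₀}`;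
the global rational-coefficient Remark (7.5) consequence of the named fact makes `W` algebraic on every chart fibre; sweep.
[cite: Bloch1972Semiregularity, Thm. (7.4) and Remark (7.5), p. 65; Thm. (7.1), p. 64] [cite: BuchweitzFlenner2003, Thm. 5.2]
[cite: CattaniDeligneKaplan1995JAMS, Thm. 1.1 and Cor. 1.2] [cite: DeligneHodgeII1971, Théorème 4.1.1] -/
theorem hc_on_siegelComponent_of_semiregular_subscheme_of_smul_add (hA : SiegelHodgeLocusChart g δ N) {p : ℕ}
    (hBS : BlochSemiregularSpreadOfSubscheme g p) (D : SiegelModuliDatum g δ N) (C : HodgeLocusComponent D.f g p)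
    (Λ : complexBetti D.𝒳 (2 * p))
    (hΛ : ∀ s : ComplexPoints D.S, IsRationalClass (Res[D.f, s, 2 * p, Λ]) ∧
      IsOfHodgeType g (fiberOver D.f s) (2 * p) p p (Res[D.f, s, 2 * p, Λ]))
    (hΛalg : ∀ s : ComplexPoints D.S, Res[D.f, s, 2 * p, Λ] ∈ algebraicClasses (fiberOver D.f s) p)
    {x₀ : FiberClass D.f (2 * p)} (hx₀ : x₀ ∈ C.carrier) (a b : ℚ) (ha : a ≠ 0)
    (d : ℕ) (hdp : d + p = g) (ρ : ResolutionFamily (fiberOver D.f x₀.pt) d)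
    {Z : Scheme.{0}} (i : Z ⟶ (fiberOver D.f x₀.pt).left) [IsLocallyNoetherian Z] (hi : IsClosedImmersion i)
    (hreg : IsRegularImmersionOfCodim i p) (hcodim : ∀ z ∈ Set.range i.base, (p : ℕ∞) ≤ Order.coheight z)
    (hsr : IsBlochSemiregular i g p) (hmem : subschemeCycle i hi ∈ cyclesOfDim (fiberOver D.f x₀.pt).left d)
    (hcls : (a : ℂ) • x₀.cls + (b : ℂ) • Res[D.f, x₀.pt, 2 * p, Λ] =
      subschemeClass (D.isSmoothProjectiveFamily.isSmoothProjective x₀.pt) hdp ρ i hi) :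
    ∀ x ∈ C.carrier, x.cls ∈ algebraicClasses (fiberOver D.f x.pt) p := by
  obtain ⟨𝒳, T, f, Φ, W, hf, h𝒳, hT, hTs, hTi, hW, hΦ, hsw⟩ := hA D p C
  haveI := hTi
  -- the pulled-back class `L = Φ^*Λ`: fibrewise rational `(p,p)` and algebraic (every chart fibre is a fibre of `D.f`)
  set L : complexBetti 𝒳 (2 * p) := complexBetti.map Φ (2 * p) Λ with hLdef
  have hLfib : ∀ u : ComplexPoints T, (IsRationalClass (Res[f, u, 2 * p, L]) ∧
      IsOfHodgeType g (fiberOver f u) (2 * p) p p (Res[f, u, 2 * p, L])) ∧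
      Res[f, u, 2 * p, L] ∈ algebraicClasses (fiberOver f u) p := by
    intro u
    obtain ⟨s, e, he⟩ := hΦ u
    have hres : Res[f, u, 2 * p, L] = complexBetti.map e.hom (2 * p) (Res[D.f, s, 2 * p, Λ]) := by
      rw [hLdef, map_res_eq_res_map_of_comm e he]
    rw [hres]
    exact ⟨⟨(isRationalClass_map_iff_of_iso e).2 (hΛ s).1, (isOfHodgeType_map_iff_of_iso e).2 (hΛ s).2⟩,
      (mem_algebraicClasses_map_iff_of_iso e).2 (hΛalg s)⟩
  -- the special point on the chart; the class identity read through `e₀.symm : 𝒴_{t₀} ≅ 𝒳_{u₀}`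
  obtain ⟨u₀, e₀, he₀Φ, he₀⟩ := hsw x₀ hx₀
  have hx : ((a : ℚ) : ℂ) • complexBetti.map e₀.symm.hom (2 * p) (Res[f, u₀, 2 * p, W]) +
      ((b : ℚ) : ℂ) • complexBetti.map e₀.symm.hom (2 * p) (Res[f, u₀, 2 * p, L]) =
      subschemeClass (D.isSmoothProjectiveFamily.isSmoothProjective x₀.pt) hdp ρ i hi := by
    rw [← he₀, hLdef, ← map_res_eq_res_map_of_comm e₀ he₀Φ, Iso.symm_hom, e₀.complexBetti_map_inv_map_hom,
      e₀.complexBetti_map_inv_map_hom]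
    exact hcls
  -- Bloch (7.4)/(7.5), global along the chart base: `W` is algebraic on every chart fibre
  have hWalg : ∀ u : ComplexPoints T, Res[f, u, 2 * p, W] ∈ algebraicClasses (fiberOver f u) p := fun u =>
    hBS.forall_mem_algebraicClasses_of_rat_smul_add charlesSchnell_algebraicityLocus_iUnion_closed_holds
      (fiberOver D.f x₀.pt) Z i f u₀ e₀.symm W L a b ha (D.isSmoothProjectiveFamily.isSmoothProjective x₀.pt)
      d hdp ρ hi hreg hcodim hsr hmem hf h𝒳 hT hTs hW (fun v => (hLfib v).1) (fun v => (hLfib v).2) hx u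
  -- sweep
  have hsweep : SweepsClasses D.f f W C.carrier := fun x hx => by
    obtain ⟨u, e, -, he⟩ := hsw x hx
    exact ⟨u, e, he⟩
  exact fun x hx => hsweep.mem_algebraicClasses hWalg hx

end Subscheme

end Summit.Ventures.HSemireg

end
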